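import Summits.CriticalPhenomena.PercolationContinuityZ3.Theorems.SahiMasterFamilySDHFlatFour
import Summits.CriticalPhenomena.PercolationContinuityZ3.Theorems.SahiMasterFamilyHFlatFour

/-!
# H♭ and SDH♭ on the LINEAR relaxation (box + top + pairwise union): the typed conjectures H♭-LIN / SDH♭-LIN, their kernel status k ≤ 4,
# and Identity 2.2 (`Λ(𝒢, β)` as a sum over the sets OUTSIDE `𝒢`) for every k

Unit `prim-masterthm-p4` (gen 18; crux anchor stmt-CriticalPhenomena-4575, helper work; memo
`run/shared/lean/prim/prim-masterthm/prim-masterthm-p4/DELETION-PICTURE.md` §2 and its 23:15Z update).  Companion of `…HFlat`, `…HFlatFour`,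
`…SDHFlat`, `…SDHFlatThree`, `…SDHFlatFour`.

The linear relaxation `Q_k` of the union-closed hull: `0 ≤ β ≤ 1`, `β_univ = 1`, `β_S + β_T ≤ 1 + β_{S∪T}`.  Every mixture of indicator functions of
union-closed families containing `univ` lies in `Q_k` (`HFlat.mixture_nonneg`, `HSharp.mixture_le_one`, `mixture_univ`, `SDHFlat.mixture_add_le_one_add_union`).
* `HFlat.HFlatLin k` — **CONJECTURE H♭-LIN(k)**: `Σ_t β_{t}·Φ_k(cap_t β) ≤ k·Φ_k(β)` on `Q_k` (conjecture-valued definition, never a fact).  Unlike H♯ (false on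
  `Q_k` from k = 5), H♭ holds on `Q_k` for k ≤ 4 in the kernel (`hFlatLin_three`, `hFlatLin_four`, from `hFlat_three_of_box` / `hFlat_four_of_pairUnion`) and for
  k = 5 by an exact `S_5`-symmetric 43-orbit LP certificate (kit j175244, not ported); **`hFlatNonneg_of_hFlatLin : HFlatLin k → HFlatNonneg k`**, so H♭-LIN for
  all k would give (UC-hull)_k — hence (GH)_k = PC-k — for all k without any use of the hull beyond pairwise union.
* `SDHFlat.SDHFlatLin k` — **CONJECTURE SDH♭-LIN(k)**: `Λ(𝒢, β) ≥ 0` for every union-closed `𝒢 ∋ univ` and every `β ∈ Q_k`; kernel k ≤ 4 (`sdhFlatLin_three`,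
  `sdhFlatLin_four`); `sdhFlatNonneg_of_sdhFlatLin : SDHFlatLin k → SDHFlatNonneg k` (hence `→ HFlatNonneg k → UCHullNonneg k`).  Its localisation LOC′(k−1) is
  FALSE on the pairwise relaxation from k−1 = 4 on (memo §3), so SDH♭-LIN(5) is open in a sharper sense than SDH♭(5).
* `SDHFlat.lam_eq_sum_caps_sub_sum_sdiff` — **Identity 2.2 for every k**: for `𝒢 ∋ univ` (no union-closure needed),
  `Λ(𝒢, β) = Σ_{t : {t} ∉ 𝒢} Φ(cap_t β) − Σ_{B ∉ 𝒢} |B|·(|B|−1)!·κ_B(β)` — `Λ` only sees the sets OUTSIDE `𝒢` (the memo's `Σ_{S∉𝒢} c_d(S)` with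
  `c({t}) = Φ(cap_t β) − κ_{t}(β) = A_{univ∖t}(d)` and `c(B) = −|B|!·κ_B(β) = |B|!·Φ_{Bᶜ}(β|)` for `|B| ≥ 2`).
HONEST FRAMING: conjecture-valued definitions and reductions; H♭-LIN / SDH♭-LIN (k ≥ 5 in the kernel, k ≥ 6 at all), H♭ (k ≥ 5), SDH♭ (k ≥ 5), (UC-hull)_k
(k ≥ 8), Sahi's `C_k` and the master theorem remain OPEN.  Axioms standard. [this work]
-/

noncomputable section

open scoped Classical

namespace Summit.CriticalPhenomena.PercolationContinuityZ3.Theorems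

open Finset
open Literature.Combinatorics.Sahi2008
open PrincipalCapBeta (phiSet)

namespace HFlat

variable {k : ℕ}

/-- **Conjecture H♭-LIN(k)**: H♭ on the linear relaxation box + top + pairwise union.  A conjecture-valued definition, never a fact. [this work]
[status: kernel k ≤ 4; k = 5 by an exact LP certificate (kit j175244); open k ≥ 6] -/
@[conjecture] def HFlatLin (k : ℕ) : Prop :=
  ∀ β : Finset (Fin k) → ℝ, (∀ B, 0 ≤ β B) → (∀ B, β B ≤ 1) → β univ = 1 → (∀ S T : Finset (Fin k), β S + β T ≤ 1 + β (S ∪ T)) →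
    ∑ t : Fin k, β {t} * phiSet k (fun S => if t ∈ S then 1 else β S) ≤ (k : ℝ) * phiSet k β

/-- A mixture of indicator functions of families containing `univ` takes the value one at `univ`. [this work] -/
theorem mixture_univ {α : Type} [Fintype α] (w : α → ℝ) (𝒰 : α → Finset (Finset (Fin k))) (hw1 : ∑ x, w x = 1)
    (htop : ∀ x, univ ∈ 𝒰 x) : (∑ x, w x * (if (univ : Finset (Fin k)) ∈ 𝒰 x then (1 : ℝ) else 0)) = 1 := by
  have : ∀ x, w x * (if (univ : Finset (Fin k)) ∈ 𝒰 x then (1 : ℝ) else 0) = w x := fun x => by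
    rw [if_pos (htop x), mul_one]
  simp only [this, hw1]

/-- **H♭-LIN(k) ⟹ H♭(k)**: the union-closed hull lies in the linear relaxation. [this work] -/
theorem hFlatNonneg_of_hFlatLin (h : HFlatLin k) : HFlatNonneg k := by
  intro α _ w 𝒰 hw0 hw1 hUC htop
  exact h _ (fun B => mixture_nonneg w 𝒰 hw0 B) (fun B => HSharp.mixture_le_one w 𝒰 hw0 hw1 B) (mixture_univ w 𝒰 hw1 htop)
    (fun S T => SDHFlat.mixture_add_le_one_add_union w 𝒰 hw0 hw1 hUC S T)

/-- Down the ladder: H♭-LIN(k) ⟹ (UC-hull)_k. [this work] -/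
theorem ucHullNonneg_of_hFlatLin (h : HFlatLin k) : GHConjecture.UCHullNonneg k :=
  ucHullNonneg_of_hFlatNonneg (hFlatNonneg_of_hFlatLin h)

/-- H♭-LIN(3) (indeed on the bare box, `hFlat_three_of_box`). [this work] -/
theorem hFlatLin_three : HFlatLin 3 := by
  intro β h0 h1 huniv _
  exact_mod_cast hFlat_three_of_box β h0 h1 huniv

/-- H♭-LIN(4) (the 31-term certificate `hFlat_four_of_pairUnion`). [this work] -/
theorem hFlatLin_four : HFlatLin 4 := by
  intro β h0 h1 huniv hu
  exact_mod_cast hFlat_four_of_pairUnion β h0 h1 huniv hu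

end HFlat

namespace SDHFlat

variable {k : ℕ}

/-- **Conjecture SDH♭-LIN(k)**: `Λ(𝒢, β) ≥ 0` for every union-closed `𝒢 ∋ univ` and every `β` in the linear relaxation.  A conjecture-valued definition,
never a fact. [this work] [status: kernel k ≤ 4; open k ≥ 5 (its localisation LOC′(4) fails on the pairwise relaxation)] -/
@[conjecture] def SDHFlatLin (k : ℕ) : Prop :=
  ∀ 𝒢 : Finset (Finset (Fin k)), (∀ A ∈ 𝒢, ∀ A' ∈ 𝒢, A ∪ A' ∈ 𝒢) → univ ∈ 𝒢 →
    ∀ β : Finset (Fin k) → ℝ, (∀ B, 0 ≤ β B) → (∀ B, β B ≤ 1) → β univ = 1 → (∀ S T : Finset (Fin k), β S + β T ≤ 1 + β (S ∪ T)) →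
      0 ≤ lam 𝒢 β

/-- **SDH♭-LIN(k) ⟹ SDH♭(k)**. [this work] -/
theorem sdhFlatNonneg_of_sdhFlatLin (h : SDHFlatLin k) : SDHFlatNonneg k := by
  intro α _ w 𝒰 hw0 hw1 hUC htop 𝒢 hG hGtop
  exact h 𝒢 hG hGtop _ (fun B => HFlat.mixture_nonneg w 𝒰 hw0 B) (fun B => HSharp.mixture_le_one w 𝒰 hw0 hw1 B)
    (HFlat.mixture_univ w 𝒰 hw1 htop) (fun S T => mixture_add_le_one_add_union w 𝒰 hw0 hw1 hUC S T)

/-- Down the ladder: SDH♭-LIN(k) ⟹ H♭(k) ⟹ (UC-hull)_k. [this work] -/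
theorem ucHullNonneg_of_sdhFlatLin (h : SDHFlatLin k) : GHConjecture.UCHullNonneg k :=
  ucHullNonneg_of_sdhFlatNonneg (sdhFlatNonneg_of_sdhFlatLin h)

/-- SDH♭-LIN(3) (on the bare box, for every family containing `univ`: `lam_three_nonneg_of_box`). [this work] -/
theorem sdhFlatLin_three : SDHFlatLin 3 := by
  intro 𝒢 _ htop β h0 h1 _ _
  exact lam_three_nonneg_of_box 𝒢 htop β h0 h1

/-- SDH♭-LIN(4) (the LOC′(3) mechanism, `lam_four_nonneg_of_pairUnion`). [this work] -/
theorem sdhFlatLin_four : SDHFlatLin 4 := by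
  intro 𝒢 hG htop β h0 h1 _ hu
  exact lam_four_nonneg_of_pairUnion 𝒢 hG htop β h0 h1 hu

/-! ### Identity 2.2: `Λ` only sees the sets outside `𝒢` -/

/-- **Identity 2.2** (every k, every family `𝒢 ∋ univ`, every set function):
`Λ(𝒢, β) = Σ_{t : {t}∉𝒢} Φ_{k+1}(cap_t β) − Σ_{B∉𝒢} |B|·(|B|−1)!·κ_B(β)`. [this work] -/
theorem lam_eq_sum_caps_sub_sum_sdiff (𝒢 : Finset (Finset (Fin (k + 1)))) (β : Finset (Fin (k + 1)) → ℝ) :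
    lam 𝒢 β = (∑ t : Fin (k + 1), (if ({t} : Finset (Fin (k + 1))) ∈ 𝒢 then (0 : ℝ) else 1) *
                  phiSet (k + 1) (fun S => if t ∈ S then 1 else β S))
      - ∑ B ∈ univ \ 𝒢, ((B.card : ℝ) * ((B.card - 1).factorial : ℝ)) * blockCoef β B := by
  have hsplit : hyb 𝒢 β = hyb (univ : Finset (Finset (Fin (k + 1)))) β
      - ∑ B ∈ univ \ 𝒢, ((B.card : ℝ) * ((B.card - 1).factorial : ℝ)) * blockCoef β B := by
    unfold hyb
    rw [← sum_sdiff (subset_univ 𝒢)]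
    ring
  unfold lam
  rw [hsplit, hyb_univ_eq_sum_caps]
  have e : (∑ t : Fin (k + 1), (if ({t} : Finset (Fin (k + 1))) ∈ 𝒢 then (0 : ℝ) else 1) *
        phiSet (k + 1) (fun S => if t ∈ S then 1 else β S))
      = (∑ t : Fin (k + 1), phiSet (k + 1) (fun S => if t ∈ S then 1 else β S))
        - ∑ t : Fin (k + 1), (if ({t} : Finset (Fin (k + 1))) ∈ 𝒢 then (1 : ℝ) else 0) *
            phiSet (k + 1) (fun S => if t ∈ S then 1 else β S) := by
    rw [← sum_sub_distrib]
    refine sum_congr rfl fun t _ => ?_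
    split_ifs <;> ring
  rw [e]
  ring

end SDHFlat

end Summit.CriticalPhenomena.PercolationContinuityZ3.Theorems
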